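import Summits.Ventures.PercRepro.C026CutVertexB2

/-!
# mine-3's Theorem B (B3): the C-026 slack over a cut vertex separating `b` from `a, c` (p5, gen 15)

mine-3 (`proofs/MINE3-BLOCKS.md` §1 (B3), §2): if `v ∉ {a, b, c}` is a cut vertex with `b` on one side and
`a, c` on the other, then with `u = #{v ~ b}(G₂)`, `t = #{v ≁ b}(G₂)`, `p = #{v ~ b, b ≁̄ v}(G₂)`,
`Y = #{a ~ c}(G₁)` and `P_v(G₁) = {a ~ v, c ~̄ v, c ≁̄ a}`,
`Δ_CF(G) = u·Δ_CF(G₁; a, v, c) + t·Y − p·#P_v(G₁)` (**`slackCF_cut_b`**). Here `v` is the cut vertex of the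
two-colouring (`IsGluing v v v side`), `a, c` on side `true`, `b` on side `false`. (B4), the pendant mark, is
the case of a one-edge `b`-side (`u = t = p = 1`); Corollary B (i) needs Theorem P (a), `#P_v ≤ Y`, which is
not in the tree.
-/

namespace PercRepro

open Finset

namespace MultiGraph

section CutVertexB3

variable {V E : Type*} {G : MultiGraph V E}

open Classical in
/-- **THEOREM B (B3)**: `Δ_CF(G) = u·Δ_CF(G₁; a, v, c) + t·Y − p·#P_v(G₁)` for a cut vertex `v ∉ {a, b, c}`
with `a, c` on side `true` and `b` on side `false`. -/
theorem slackCF_cut_b [Fintype E] {v : V} {side : E → Bool} (hg : G.IsGluing v v v side) {a b c : V}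
    (ha : G.OnSide side true a) (hb : G.OnSide side false b) (hc : G.OnSide side true c)
    (hab : a ≠ b) (hcb : c ≠ b) :
    G.slackCF a b c =
      ((univ.filter fun ω₂ : Config {e // side e = false} => (G.part side false).Conn ω₂ v b).card : ℤ) *
          (G.part side true).slackCF a v c +
        ((univ.filter fun ω₂ : Config {e // side e = false} =>
            ¬ (G.part side false).Conn ω₂ v b).card : ℤ) *
          ((univ.filter fun ω₁ : Config {e // side e = true} => (G.part side true).Conn ω₁ c a).card : ℤ) -
        ((univ.filter fun ω₂ : Config {e // side e = false} =>
            (G.part side false).Conn ω₂ v b ∧ ¬ (G.part side false).Conn ω₂ᶜ v b).card : ℤ) *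
          ((univ.filter fun ω₁ : Config {e // side e = true} =>
            (G.part side true).Conn ω₁ a v ∧ (G.part side true).Conn ω₁ᶜ c v ∧
              ¬ (G.part side true).Conn ω₁ᶜ c a).card : ℤ) := by
  have htf : true ≠ false := by decide
  -- the dictionary at the marks
  have dab : ∀ ω : Config E, G.Conn ω a b ↔
      (G.part side true).Conn (sideRestrict ω side true) a v ∧
        (G.part side false).Conn (sideRestrict ω side false) v b :=
    fun ω => conn_cut_iff_cross hg htf (Or.inr ha) hb hab ω
  have dcb : ∀ ω : Config E, G.Conn ω c b ↔
      (G.part side true).Conn (sideRestrict ω side true) c v ∧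
        (G.part side false).Conn (sideRestrict ω side false) v b :=
    fun ω => conn_cut_iff_cross hg htf (Or.inr hc) hb hcb ω
  have dac : ∀ ω : Config E, G.Conn ω a c ↔
      (G.part side true).Conn (sideRestrict ω side true) a c :=
    fun ω => conn_cut_iff_same hg htf (Or.inr ha) (Or.inr hc) ω
  have dca : ∀ ω : Config E, G.Conn ω c a ↔
      (G.part side true).Conn (sideRestrict ω side true) c a :=
    fun ω => conn_cut_iff_same hg htf (Or.inr hc) (Or.inr ha) ω
  -- the cells of `G` as product events
  have h_ab : (univ.filter fun ω : Config E => G.Conn ω a b ∧ ¬ G.Conn ω a c).card =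
      (univ.filter fun ω₁ : Config {e // side e = true} =>
          (G.part side true).Conn ω₁ a v ∧ ¬ (G.part side true).Conn ω₁ a c).card *
        (univ.filter fun ω₂ : Config {e // side e = false} => (G.part side false).Conn ω₂ v b).card := by
    have e1 : (univ.filter fun ω : Config E => G.Conn ω a b ∧ ¬ G.Conn ω a c) =
        (univ.filter fun ω : Config E =>
          ((G.part side true).Conn (sideRestrict ω side true) a v ∧
            ¬ (G.part side true).Conn (sideRestrict ω side true) a c) ∧
          (G.part side false).Conn (sideRestrict ω side false) v b) :=
      Finset.filter_congr fun ω _ => by rw [dab, dac]; tauto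
    rw [e1]
    convert card_filter_cut side
      (fun ω₁ : Config {e // side e = true} =>
        (G.part side true).Conn ω₁ a v ∧ ¬ (G.part side true).Conn ω₁ a c)
      (fun ω₂ : Config {e // side e = false} => (G.part side false).Conn ω₂ v b) using 4
  have h_bc : (univ.filter fun ω : Config E => G.Conn ω c b ∧ ¬ G.Conn ω c a).card =
      (univ.filter fun ω₁ : Config {e // side e = true} =>
          (G.part side true).Conn ω₁ c v ∧ ¬ (G.part side true).Conn ω₁ c a).card *
        (univ.filter fun ω₂ : Config {e // side e = false} => (G.part side false).Conn ω₂ v b).card := by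
    have e1 : (univ.filter fun ω : Config E => G.Conn ω c b ∧ ¬ G.Conn ω c a) =
        (univ.filter fun ω : Config E =>
          ((G.part side true).Conn (sideRestrict ω side true) c v ∧
            ¬ (G.part side true).Conn (sideRestrict ω side true) c a) ∧
          (G.part side false).Conn (sideRestrict ω side false) v b) :=
      Finset.filter_congr fun ω _ => by rw [dcb, dca]; tauto
    rw [e1]
    convert card_filter_cut side
      (fun ω₁ : Config {e // side e = true} =>
        (G.part side true).Conn ω₁ c v ∧ ¬ (G.part side true).Conn ω₁ c a)
      (fun ω₂ : Config {e // side e = false} => (G.part side false).Conn ω₂ v b) using 4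
  have h_ac : (univ.filter fun ω : Config E => G.Conn ω c a ∧ ¬ G.Conn ω c b).card =
      (univ.filter fun ω₁ : Config {e // side e = true} =>
          (G.part side true).Conn ω₁ c a ∧ ¬ (G.part side true).Conn ω₁ c v).card *
        (univ.filter fun ω₂ : Config {e // side e = false} => (G.part side false).Conn ω₂ v b).card +
      (univ.filter fun ω₁ : Config {e // side e = true} => (G.part side true).Conn ω₁ c a).card *
        (univ.filter fun ω₂ : Config {e // side e = false} =>
          ¬ (G.part side false).Conn ω₂ v b).card := by
    rw [← Finset.card_filter_add_card_filter_not
        (fun ω : Config E => (G.part side false).Conn (sideRestrict ω side false) v b),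
      Finset.filter_filter, Finset.filter_filter]
    congr 1
    · have e1 : (univ.filter fun ω : Config E => (G.Conn ω c a ∧ ¬ G.Conn ω c b) ∧
          (G.part side false).Conn (sideRestrict ω side false) v b) =
          (univ.filter fun ω : Config E =>
            ((G.part side true).Conn (sideRestrict ω side true) c a ∧
              ¬ (G.part side true).Conn (sideRestrict ω side true) c v) ∧
            (G.part side false).Conn (sideRestrict ω side false) v b) :=
        Finset.filter_congr fun ω _ => by rw [dca, dcb]; tauto
      rw [e1]
      convert card_filter_cut side
        (fun ω₁ : Config {e // side e = true} =>
          (G.part side true).Conn ω₁ c a ∧ ¬ (G.part side true).Conn ω₁ c v)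
        (fun ω₂ : Config {e // side e = false} => (G.part side false).Conn ω₂ v b) using 4
    · have e1 : (univ.filter fun ω : Config E => (G.Conn ω c a ∧ ¬ G.Conn ω c b) ∧
          ¬ (G.part side false).Conn (sideRestrict ω side false) v b) =
          (univ.filter fun ω : Config E => (G.part side true).Conn (sideRestrict ω side true) c a ∧
            ¬ (G.part side false).Conn (sideRestrict ω side false) v b) :=
        Finset.filter_congr fun ω _ => by rw [dca, dcb]; tauto
      rw [e1]
      convert card_filter_cut side
        (fun ω₁ : Config {e // side e = true} => (G.part side true).Conn ω₁ c a)
        (fun ω₂ : Config {e // side e = false} => ¬ (G.part side false).Conn ω₂ v b) using 4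
  have h_N : (univ.filter fun ω : Config E =>
      G.Conn ω a b ∧ ¬ G.Conn ωᶜ c a ∧ ¬ G.Conn ωᶜ c b).card =
      (univ.filter fun ω₁ : Config {e // side e = true} =>
          (G.part side true).Conn ω₁ a v ∧ ¬ (G.part side true).Conn ω₁ᶜ c a ∧
            ¬ (G.part side true).Conn ω₁ᶜ c v).card *
        (univ.filter fun ω₂ : Config {e // side e = false} => (G.part side false).Conn ω₂ v b).card +
      (univ.filter fun ω₁ : Config {e // side e = true} =>
          (G.part side true).Conn ω₁ a v ∧ (G.part side true).Conn ω₁ᶜ c v ∧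
            ¬ (G.part side true).Conn ω₁ᶜ c a).card *
        (univ.filter fun ω₂ : Config {e // side e = false} =>
          (G.part side false).Conn ω₂ v b ∧ ¬ (G.part side false).Conn ω₂ᶜ v b).card := by
    rw [← Finset.card_filter_add_card_filter_not
        (fun ω : Config E => (G.part side true).Conn (sideRestrict ω side true)ᶜ c v),
      Finset.filter_filter, Finset.filter_filter, add_comm]
    congr 1
    · have e1 : (univ.filter fun ω : Config E =>
          (G.Conn ω a b ∧ ¬ G.Conn ωᶜ c a ∧ ¬ G.Conn ωᶜ c b) ∧
            ¬ (G.part side true).Conn (sideRestrict ω side true)ᶜ c v) =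
          (univ.filter fun ω : Config E =>
            ((G.part side true).Conn (sideRestrict ω side true) a v ∧
              ¬ (G.part side true).Conn (sideRestrict ω side true)ᶜ c a ∧
                ¬ (G.part side true).Conn (sideRestrict ω side true)ᶜ c v) ∧
            (G.part side false).Conn (sideRestrict ω side false) v b) :=
        Finset.filter_congr fun ω _ => by
          rw [dab, dca, dcb, sideRestrict_compl, sideRestrict_compl]; tauto
      rw [e1]
      convert card_filter_cut side
        (fun ω₁ : Config {e // side e = true} =>
          (G.part side true).Conn ω₁ a v ∧ ¬ (G.part side true).Conn ω₁ᶜ c a ∧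
            ¬ (G.part side true).Conn ω₁ᶜ c v)
        (fun ω₂ : Config {e // side e = false} => (G.part side false).Conn ω₂ v b) using 4
    · have e1 : (univ.filter fun ω : Config E =>
          (G.Conn ω a b ∧ ¬ G.Conn ωᶜ c a ∧ ¬ G.Conn ωᶜ c b) ∧
            (G.part side true).Conn (sideRestrict ω side true)ᶜ c v) =
          (univ.filter fun ω : Config E =>
            ((G.part side true).Conn (sideRestrict ω side true) a v ∧
              (G.part side true).Conn (sideRestrict ω side true)ᶜ c v ∧
                ¬ (G.part side true).Conn (sideRestrict ω side true)ᶜ c a) ∧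
            ((G.part side false).Conn (sideRestrict ω side false) v b ∧
              ¬ (G.part side false).Conn (sideRestrict ω side false)ᶜ v b)) :=
        Finset.filter_congr fun ω _ => by
          rw [dab, dca, dcb, sideRestrict_compl, sideRestrict_compl]; tauto
      rw [e1]
      convert card_filter_cut side
        (fun ω₁ : Config {e // side e = true} =>
          (G.part side true).Conn ω₁ a v ∧ (G.part side true).Conn ω₁ᶜ c v ∧
            ¬ (G.part side true).Conn ω₁ᶜ c a)
        (fun ω₂ : Config {e // side e = false} =>
          (G.part side false).Conn ω₂ v b ∧ ¬ (G.part side false).Conn ω₂ᶜ v b) using 4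
  unfold slackCF
  rw [h_ab, h_ac, h_bc, h_N]
  push_cast
  have key : ∀ (Z₁ U Z₂ T Y Z₃ N P Q : ℤ),
      Z₁ * U + (Z₂ * U + Y * T) + Z₃ * U - (N * U + P * Q) =
        U * (Z₁ + Z₂ + Z₃ - N) + T * Y - Q * P :=
    fun _ _ _ _ _ _ _ _ _ => by ring
  convert key _ _ _ _ _ _ _ _ _ using 10 <;> (repeat first | rfl | exact Subsingleton.elim _ _ | congr 1)

end CutVertexB3

end MultiGraph

end PercRepro
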